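import Summits.QuantumAdvantage.QuantumAdvantage.Theses.LinnikCubicClassGroups
import Literature.Computability.Complexity.ListFoldBricks
import Literature.Computability.Complexity.RandomizedProofs

/-!
# Crux `LinnikCubicClassGroups.PureCubicClassNumberHard` (stmt-QuantumAdvantage-11826) —
# stub `stub_modThree_polyTime`

Line `Sketch` (honda-leak arm), stub `stub_modThree_polyTime` (S): the post-processing
`l ↦ [⟦l⟧ ≡ 0 (mod 3)]` (`⟦l⟧ = bitsToNat l`, the LSB-first binary value of the word `l`) is
polynomial-time as a map `List Bool → Bool` under the encoders `id` (input) and `encodeBool`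
(output). Pure brick algebra, no machine is built:

* the word function `Brick.eqValFn ∘ fanoutFn (Brick.remFn ∘ fanoutFn id (fun _ => encodeNat 3)) (fun _ => [])`
  is in `FP` (`Brick.eqValFn_mem_FP`, `Brick.remFn_mem_FP`, `fanoutFn_mem_FP`, `comp_mem_FP`,
  `const_mem_FP`, `PolyTimeComputable.id`);
* its value at `l` is `[decide (bitsToNat l % 3 = 0)]` (`Brick.remFn_boolPair`,
  `Brick.eqValFn_boolPair`, `bitsToNat_encodeNat`, `bitsToNat_nil`);
* transport along `encodeBool b = [b]` by `PolyTimeComputable.of_encode_eq`.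
-/

namespace Summit.QuantumAdvantage.QuantumAdvantage.Theorems.LinnikCubicClassGroups

open Literature.Computability.Complexity _root_.Computability

/-- The word function `l ↦ eqValFn ⟨remFn ⟨l, encodeNat 3⟩, ε⟩` is in `FP` (closure of `FP` under
composition and fan-out, from the tree's bricks). -/
theorem modThreeFn_mem_FP :
    (Brick.eqValFn ∘ fanoutFn (Brick.remFn ∘ fanoutFn id (fun _ => encodeNat 3)) (fun _ => []))
      ∈ FP :=
  comp_mem_FP Brick.eqValFn_mem_FP
    (fanoutFn_mem_FP
      (comp_mem_FP Brick.remFn_mem_FP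
        (fanoutFn_mem_FP (PolyTimeComputable.id (id : List Bool → List Bool))
          (const_mem_FP (encodeNat 3))))
      (const_mem_FP []))

/-- Value of the word function: `eqValFn ⟨remFn ⟨l, encodeNat 3⟩, ε⟩ = [decide (⟦l⟧ mod 3 = 0)]`. -/
theorem modThreeFn_apply (l : List Bool) :
    (Brick.eqValFn ∘ fanoutFn (Brick.remFn ∘ fanoutFn id (fun _ => encodeNat 3)) (fun _ => [])) l
      = [decide (bitsToNat l % 3 = 0)] := by
  simp [Function.comp]

/-- **Stub `stub_modThree_polyTime`**: the post-processing `l ↦ [⟦l⟧ ≡ 0 (mod 3)]` is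
polynomial-time as a map `List Bool → Bool` under the encoders `id`, `encodeBool`. -/
theorem stub_modThree_polyTime :
    PolyTimeComputable (id : List Bool → List Bool) encodeBool
      (fun l : List Bool => decide (bitsToNat l % 3 = 0)) :=
  PolyTimeComputable.of_encode_eq
    (f := Brick.eqValFn ∘ fanoutFn (Brick.remFn ∘ fanoutFn id (fun _ => encodeNat 3)) (fun _ => []))
    (ea := (id : List Bool → List Bool)) (eb := (id : List Bool → List Bool))
    (id : List Bool → List Bool) (fun _ => rfl)
    (fun l => by rw [id, modThreeFn_apply]; rfl) modThreeFn_mem_FP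

end Summit.QuantumAdvantage.QuantumAdvantage.Theorems.LinnikCubicClassGroups
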